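import Mathlib
import HarnessLib
import Literature.MathematicalPhysics.QuantumLattice.HubbardFermiLiquid
import Literature.MathematicalPhysics.QuantumLattice.PairCorrelations
import Literature.MathematicalPhysics.QuantumLattice.DuhamelTwoPoint

/-!
# Route `KLProgramme` — definitions D3 `PairSusceptibility`: the finite-volume thermal pair-field susceptibility per form
# factor, the grand-canonical density, their thermodynamic limits, and the SHAPES of H1.ii / H1.iii (DECOMP App. B′)

The route file (`Theses/KLProgramme.lean`, DEFINITION REQUESTS: "D3 `thermalPairSusceptibility`", NOT DECOMPOSED YET:
"H1.ii (running couplings) and H1.iii (density-matched d-wave enhancement, `H1DWaveEnhancementMatched`) — corollary statements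
filed after K3's split") and the cell's definition item `defn-HubbardPairSusceptibilityIrrep` ask for the vocabulary of the
papers-target statements H1.ii/H1.iii of the LADDER-Hubbard rung R2d (survey §1 (a)(ii): "the static pair susceptibilities in the
even-parity one-dimensional `D₄` channels satisfy `χ_{B1g}(T,U) ≥ χ₀(T)(1 + κU² log(W/T))` while the other channels are
`≤ χ₀(1 + CU)`").  The planner's vocabulary module `Literature/…/HubbardKLProgramme.lean` is dead (route-posited objects live in
`Theorems/KLProgramme…Defs.lean`, DECOMP v7 §0); this file lands the shapes of planner Sketch-g3 (App. B′, review finding R3)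
VERBATIM over existing tree vocabulary — `hubbardTorusWith`, `pairField g L` / `localPair` (form factor `g` on the bond set
`{0, ±e₁, ±e₂}`, `PairCorrelations.lean`), `Matrix.duhamel` (`DuhamelTwoPoint.lean`), `hubbardThermalTwoPoint`
(`HubbardFermiLiquid.lean`), `dWaveFormFactor` / `extendedSWave` / `sWave` — plus the thermodynamic-limit bookkeeping:

* `thermalPairSusceptibility g β U μ L` — Scalapino's `P_g = ∫₀^β ⟨Δ_g(τ)† Δ_g(0)⟩ dτ / |Λ|` (up to the tree's `√2` normalisation of
  `pairField`) as `β · Re (Δ_g†, Δ_g)_Duhamel / L²` in the Gibbs state of `hubbardTorusWith 2 L 1 U μ`;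
* `thermalDensity β U μ L = Σ_σ ⟨c†_{0σ} c_{0σ}⟩` (density matching pins the Hartree shift honestly, R3);
* `thermalPairSusceptibilityLimit`, `ThermalPairSusceptibilityConverges` — the `L → ∞` limit as `limUnder` with its existence
  predicate kept separate (junk-free consumers quantify the predicate);
* the nearest-neighbour `D₄` form factors available on the bond set of `localPair`: `A₁g` = `extendedSWave` / `sWave`, `B₁g` =
  `dWaveFormFactor` (tree), `E` = `pWaveFormFactorX` (new; odd, so `Δ_g` is the `S_z = 0` triplet pair); `B₂g` (`d_{xy}`) and
  `A₂g` vanish identically on this bond set (they live on diagonal / longer bonds) and are NOT provided — a longer-bond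
  `localPair` is a separate definition request if the planner wants all five channels;
* SHAPES (Prop-valued, parameters `μa μb`; nothing asserted): `H1DWaveEnhancementMatched` (H1.iii of record, Sketch-g3 verbatim),
  `H1ChannelNoLogEnhancement g` (H1.ii's "no log-enhancement at order `U²`" for a channel `g`, same density matching).

Design: finite `(β, L)` objects with junk `0` at `L = 0` exactly as `hubbardThermalTwoPoint`; limits as `limUnder` + predicate;
the shapes quantify `∀ᶠ L in atTop` (no `liminf` junk) and match densities EXACTLY (`∀ ν` with equal densities — non-vacuous
since the free density is continuous and onto `(0, 2)` in `ν`; no `∃ ν, |ν| ≤ CU` slack), per review finding R3 of DECOMP App. B′.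
Not load-bearing for the leaf `H1TwoPointLimitKLScaleD`.

References: D. J. Scalapino, Phys. Rep. 250 (1995) 329, §2 (2.2)–(2.4) (pair-field susceptibility); F. J. Dyson, E. H. Lieb,
B. Simon, J. Stat. Phys. 18 (1978) 335, eq. (5) (Duhamel two-point function); S. Raghu, S. A. Kivelson, D. J. Scalapino,
Phys. Rev. B 81 (2010) 224505, §II–III (channel susceptibilities); cell gate-hubbard-kl DECOMP v7 §1, App. B/B′.
-/

noncomputable section

namespace Summit.HubbardSuperconductivity.HubbardSuperconductivity.Theorems.KLProgrammePairSusceptibility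

set_option linter.dupNamespace false -- summit = problem name (single-conjunct summit), D-0017

open Filter Topology
open scoped Matrix
open Literature.MathematicalPhysics.QuantumLattice Literature.Probability.LatticeModels

/-! ### Finite-volume objects -/

/-- **The finite-volume thermal pair-field susceptibility** with form factor `g` (Scalapino's
`P_g = ∫₀^β ⟨Δ_g(τ)† Δ_g(0)⟩ dτ / |Λ|`, up to the tree's `√2` normalisation of `pairField`):
`β · Re (Δ_g†, Δ_g)_Duhamel / L²` in the Gibbs state of `hubbardTorusWith 2 L 1 U μ` at inverse temperature `β`
(`Matrix.duhamel β H A B = Z⁻¹ ∫₀¹ tr(A e^{-sβH} B e^{-(1-s)βH}) ds`).  Junk `0` at `L = 0`.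
[cite: Scalapino1995, §2 (2.4)] -/
def thermalPairSusceptibility (g : Site 2 → ℝ) (β U μ : ℝ) (L : ℕ) : ℝ :=
  if hL : L = 0 then 0
  else
    haveI : NeZero L := ⟨hL⟩
    β * (Matrix.duhamel β (hubbardTorusWith 2 L 1 U μ) (pairField g L)ᴴ (pairField g L)).re / (L : ℝ) ^ 2

/-- **The finite-volume grand-canonical density** `n(β,U,μ,L) = Σ_σ ⟨c†_{0σ} c_{0σ}⟩` of `hubbardTorusWith 2 L 1 U μ` (equal-time
two-point function on the diagonal; translation invariance makes the site irrelevant; junk `0` at `L = 0`). [folklore] -/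
def thermalDensity (β U μ : ℝ) (L : ℕ) : ℝ :=
  ∑ σ : Fin 2, (hubbardThermalTwoPoint β U μ L 0 0 σ σ).re

/-- The nearest-neighbour `p_x`-wave form factor (irrep `E` of `D₄`): `+e₁ ↦ 1`, `-e₁ ↦ -1`, `0` otherwise (odd, so the pair
field `Δ_g` of `localPair` is the `S_z = 0` triplet pair along `x`). [cite: Scalapino1995, §2 (2.3)] -/
def pWaveFormFactorX (e : Site 2) : ℝ :=
  if e = Pi.single 0 1 then 1 else if e = -Pi.single 0 1 then -1 else 0

/-! ### Thermodynamic limits -/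

/-- The pair-field susceptibility converges as `L → ∞` (existence predicate, kept separate from the value). [folklore] -/
def ThermalPairSusceptibilityConverges (g : Site 2 → ℝ) (β U μ : ℝ) : Prop :=
  ∃ P : ℝ, Tendsto (fun L : ℕ => thermalPairSusceptibility g β U μ L) atTop (𝓝 P)

/-- **The thermodynamic-limit pair-field susceptibility** `P_g(β,U,μ) = lim_{L→∞} P_g(β,U,μ,L)` (`limUnder`; meaningful under
`ThermalPairSusceptibilityConverges`). [cite: Scalapino1995, §2 (2.4)] -/
def thermalPairSusceptibilityLimit (g : Site 2 → ℝ) (β U μ : ℝ) : ℝ :=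
  limUnder atTop fun L : ℕ => thermalPairSusceptibility g β U μ L

/-- The density converges as `L → ∞`. [folklore] -/
def ThermalDensityConverges (β U μ : ℝ) : Prop :=
  ∃ n : ℝ, Tendsto (fun L : ℕ => thermalDensity β U μ L) atTop (𝓝 n)

/-- The thermodynamic-limit density `n(β,U,μ) = lim_{L→∞} n(β,U,μ,L)` (`limUnder`). [folklore] -/
def thermalDensityLimit (β U μ : ℝ) : ℝ :=
  limUnder atTop fun L : ℕ => thermalDensity β U μ L

/-! ### Shapes of H1.iii and H1.ii (Prop-valued; nothing asserted) -/

/-- **H1.iii, density-MATCHED form** (DECOMP App. B′, review finding R3). On the `μ`-window `[μa, μb]` there are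
`U₀, c, κ, β₁ > 0` such that for `0 < U ≤ U₀`, `β₁ ≤ β ≤ e^{c/U²}` and all large `L`: for EVERY shift `ν` at which the free torus
has the interacting density (this pins `ν` = the Hartree shift; no slack, and non-vacuous since the free density is continuous and
onto `(0,2)` in `ν`), the interacting `d_{x²-y²}` pair-field susceptibility exceeds the free one at `μ + ν` by the Kohn–Luttinger
logarithm: `(1 + κU² log β) · P_d(β,0,μ+ν,L) ≤ P_d(β,U,μ,L)`. [cite: RaghuKivelsonScalapino2010, §III] -/
def H1DWaveEnhancementMatched (μa μb : ℝ) : Prop :=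
  ∃ U₀ c κ β₁ : ℝ, 0 < U₀ ∧ 0 < c ∧ 0 < κ ∧ 0 < β₁ ∧
    ∀ μ ∈ Set.Icc μa μb, ∀ U β : ℝ, 0 < U → U ≤ U₀ → β₁ ≤ β → β ≤ Real.exp (c / U ^ 2) →
      ∀ᶠ L : ℕ in atTop, ∀ ν : ℝ,
        thermalDensity β 0 (μ + ν) L = thermalDensity β U μ L →
          (1 + κ * U ^ 2 * Real.log β) * thermalPairSusceptibility dWaveFormFactor β 0 (μ + ν) L
            ≤ thermalPairSusceptibility dWaveFormFactor β U μ L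

/-- **H1.ii, no-log-enhancement shape for a channel `g`** (survey §1 (a)(ii): "`χ_{A1g}`, `χ_{B2g}` and the p-wave/SDW channels are
`≤ χ₀(1 + CU)` — no log-enhancement at order `U²`"), density-matched as in `H1DWaveEnhancementMatched`: on `[μa, μb]` there are
`U₀, c, C, β₁ > 0` with `P_g(β,U,μ,L) ≤ (1 + CU) · P_g(β,0,μ+ν,L)` for `0 < U ≤ U₀`, `β₁ ≤ β ≤ e^{c/U²}`, all large `L` and every
density-matching shift `ν`. [cite: RaghuKivelsonScalapino2010, §III] -/
def H1ChannelNoLogEnhancement (g : Site 2 → ℝ) (μa μb : ℝ) : Prop :=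
  ∃ U₀ c C β₁ : ℝ, 0 < U₀ ∧ 0 < c ∧ 0 < C ∧ 0 < β₁ ∧
    ∀ μ ∈ Set.Icc μa μb, ∀ U β : ℝ, 0 < U → U ≤ U₀ → β₁ ≤ β → β ≤ Real.exp (c / U ^ 2) →
      ∀ᶠ L : ℕ in atTop, ∀ ν : ℝ,
        thermalDensity β 0 (μ + ν) L = thermalDensity β U μ L →
          thermalPairSusceptibility g β U μ L ≤ (1 + C * U) * thermalPairSusceptibility g β 0 (μ + ν) L

/-! ### Bookkeeping lemmas -/

/-- Junk value at `L = 0`. [folklore] -/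
@[simp] theorem thermalPairSusceptibility_zero_size (g : Site 2 → ℝ) (β U μ : ℝ) :
    thermalPairSusceptibility g β U μ 0 = 0 := by
  simp [thermalPairSusceptibility]

/-- Junk value at `L = 0`. [folklore] -/
@[simp] theorem thermalDensity_zero_size (β U μ : ℝ) : thermalDensity β U μ 0 = 0 := by
  simp [thermalDensity, hubbardThermalTwoPoint]

/-- At `β = 0` the susceptibility vanishes (the prefactor `β`). [folklore] -/
@[simp] theorem thermalPairSusceptibility_zero_beta (g : Site 2 → ℝ) (U μ : ℝ) (L : ℕ) :
    thermalPairSusceptibility g 0 U μ L = 0 := by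
  unfold thermalPairSusceptibility
  split_ifs <;> simp

/-- Under convergence, the limit is the `limUnder` value. [folklore] -/
theorem tendsto_thermalPairSusceptibilityLimit {g : Site 2 → ℝ} {β U μ : ℝ}
    (h : ThermalPairSusceptibilityConverges g β U μ) :
    Tendsto (fun L : ℕ => thermalPairSusceptibility g β U μ L) atTop (𝓝 (thermalPairSusceptibilityLimit g β U μ)) := by
  obtain ⟨P, hP⟩ := h
  exact tendsto_nhds_limUnder ⟨P, hP⟩

/-- Under convergence, the density limit is the `limUnder` value. [folklore] -/
theorem tendsto_thermalDensityLimit {β U μ : ℝ} (h : ThermalDensityConverges β U μ) :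
    Tendsto (fun L : ℕ => thermalDensity β U μ L) atTop (𝓝 (thermalDensityLimit β U μ)) := by
  obtain ⟨n, hn⟩ := h
  exact tendsto_nhds_limUnder ⟨n, hn⟩

/-- The `p_x` form factor is odd: `g(-e) = -g(e)`. [folklore] -/
theorem pWaveFormFactorX_neg (e : Site 2) : pWaveFormFactorX (-e) = -pWaveFormFactorX e := by
  unfold pWaveFormFactorX
  have h10 : (Pi.single 0 1 : Site 2) ≠ -Pi.single 0 1 := by
    intro h; have := congrFun h 0; simp at this
  by_cases h1 : e = Pi.single 0 1
  · subst h1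
    have : -(Pi.single 0 1 : Site 2) ≠ Pi.single 0 1 := fun h => h10 h.symm
    simp [this]
  · by_cases h2 : e = -Pi.single 0 1
    · subst h2; simp [h10.symm]
    · have h3 : -e ≠ Pi.single 0 1 := fun h => h2 (by rw [← h, neg_neg])
      have h4 : -e ≠ -Pi.single 0 1 := fun h => h1 (neg_injective h)
      simp [h1, h2, h3, h4]

end Summit.HubbardSuperconductivity.HubbardSuperconductivity.Theorems.KLProgrammePairSusceptibility

end
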